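import Literature.MathematicalPhysics.QuantumFieldTheory.Balaban1983to89.B9Thm313WholeLettersCut
import Literature.MathematicalPhysics.QuantumFieldTheory.Balaban1983to89.B9Thm313WholeRgdFrom3152

/-!
# `Balaban1983to89.B9Thm313WholeCutLettersSupFrom344` — [B9] Theorem 3.13 (p. 426): the two ORDER-ZERO SUP ∕ PROBE letters of the re-cut schemas
# (`Letters313Zc.wGp` = D·G′·R·D\* on the class of G₁∇\*_U, `Letters313HZc.pWE` = its (3.45) probe) REDUCED to (3.44) ∕ (3.45) for G′ at that class,
# Theorem 3.1 (3.42)₂ ∕ (3.43)₁ for G′, (3.49) for P and R = ϱ(I − P)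

T. Bałaban, *Propagators for lattice gauge theories in a background field*, Commun. Math. Phys. **99** (1985) 389–434
[`Balaban1985BackgroundPropagators`, "B9"]; [4] = T. Bałaban, *Propagators and renormalization transformations for lattice gauge
theories. II*, Commun. Math. Phys. **96** (1984) 223–250 [`Balaban1984PropagatorsII`].

statement-level skeleton of published theorems with citation tags; proofs where landed; nothing here is a claim about the Yang–Mills
mass gap

THE PRINTED LOCUS (held text `paper:balaban1985-cmp99-background-propagators`).  p. 398, (3.44): the mixed sup entry |(∇_UG∇\*_Uλ)(x)| carries on its right
the HÖLDER norm of λ (constant B′₀(ε) → ∞ as ε → 0); (3.45): the Hölder-output twin; (3.42)₂, (3.43)₁ (∇_UG and its Hölder probe); (3.49) p. 399 (P, ∇P,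
P∇\*; R = ϱ(I − P)); p. 426: *"The formulas (3.147), (3.153) permit us to reduce properties of the operators 𝔓, 𝔊 to the corresponding properties of the
operators G′, (Q′G′²Q′\*)⁻¹, G₁, (QG₁Q\*)⁻¹"*; p. 398 remark after (3.47) ([4] (2.60)).

THE POINT (sequel of `B9Thm313WholeLettersCut`, `B9Thm313WholeCutLettersL2From3152`; same seat).  The re-cut sup ∕ probe schemas display two NEW letters for the
order-zero site word D·G′·R·D\* read on the FREE class `bXH` of G₁∇\*_U: `Letters313Zc.wGp` (into 𝔠⁽¹⁾) and `Letters313HZc.pWE β` (into the probe class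
𝔠_P^{(β−1)}).  With R = ϱ(I − P): D·G′·R·D\* = ϱ(DG′D\* − (DG′)(PD\*)).  THIS FILE reduces both letters to print's lines FOR G′ READ AT THE SAME CLASS:
* §1 `hasMaj_PDvs_cut` — PD\* : 𝔠⁽¹⁾ → 𝔠_W⁽⁰⁾ (constant C_P·L, rate δ − αδ) from (3.49) (`Proj349Maj.p2`) by one (2.60) shift; `hasMaj_DvGp_cut` — DG′ : 𝔠_W⁽⁰⁾ → 𝔠⁽¹⁾
  from Theorem 3.1 (3.42)₂ (`Thm31GpMaj.e1`);
* §2 ★★ `wGp_of_h44Gp` — `Letters313Zc.wGp`'s statement from `h44 : HasMaj bXH 𝔠⁽¹⁾ (D∘G′∘D\*) (B₄₄e^{−δ₄₄d})` ((3.44) FOR G′ AT THE CLASS `bXH`), the class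
  embedding `hX : HasMaj bXH 𝔠⁽¹⁾ id (κ_X e^{−δ_X d})` (bXH dominates the 𝔠⁽¹⁾-sup part — true for any «(sup ⊕ Hölder)∕Lʲη» class), `Thm31GpMaj`, `Proj349Maj`,
  R = ϱ•(I − P), member facts and row sum: any B₃ ≧ ϱ(B₄₄ + B₀·C_P·L₀·κ_X·c²), any δ₃ ≦ δ − αδ − 2σ (δ ≦ δ₀, δ_P; δ − αδ − σ ≦ δ_X; δ − αδ − 2σ ≦ δ₄₄);
* §3 ★★ `pWE_of_p45Gp` — `Letters313HZc.pWE β`'s statement from `hp45 : HasMaj bXH 𝔠_P^{(β−1)} (Φ^X_β∘(D∘G′∘D\*)) (B₄₅e^{−δ₄₅d})` ((3.45) for G′ at `bXH`),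
  the probe of ∇G′ `hpDG : HasMaj 𝔠_W^{(0)} 𝔠_P^{(β−1)} (Φ^X_β∘D∘G′) (B_h e^{−δ_h d})` ((3.43)₁ for G′), `hX`, `Proj349Maj`, R = ϱ•(I − P): any Bx ≧
  ϱ(B₄₅ + B_h·C_P·L₀·κ_X·c²), any δ₃ ≦ δ − αδ − 2σ.
* §4 ★ `gXH_of_closure` — `Letters313Zc.gXH`'s statement (G₁∇\*_U : Y⁰ → bXH) from Theorem 3.3's (3.42)₃ ∕ (3.43)₂-probe for G₀ (`he2`, `h43`), the steps on 𝔠⁽¹⁾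
  and on the probe class (`hK`, `hpX`), `Identities`, and the DEFINING PROPERTY of the class (`hXcl`: bXH is below the maximum of the 𝔠⁽¹⁾-sup class and
  the β₀-probe class); constant A₁ + (B_h + θ_H A₁ c).
NET for the re-cut: `wGp ∕ pWE` are (3.44) ∕ (3.45) FOR G′ (rows 18's species) + (3.43)₁ for G′ + derived material, `gXH` is rows 19's G₀ material + steps +
the class axiom; with `B9Thm313WholeCutLettersL2From3152` ALL FIVE new letters are reduced to printed-species letters for G′∕G₀ read at ONE free class `bXH`
whose two axioms (`hX` embedding into 𝔠⁽¹⁾, `hXcl` closure under sup ⊔ β₀-probe) a «(sup ⊕ β₀-Hölder)∕Lʲη» class satisfies by definition.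

HONEST SCOPE.  Kernel bookkeeping over landed schemas; NOTHING of print's estimates is asserted — (3.44)∕(3.45)∕(3.43)₁ for G′ at the class `bXH` are
HYPOTHESES of printed species.  COUNT-NEUTRAL; N06 NOT discharged; one finite lattice at a time; nothing continuum, nothing about the mass gap ∕ Clay.
Cell `pub-ymgap` (HUMAN RULING D-0062), Track A node N06 [B9], bundle F7 rows 20–21, seat `pub-ymgap-dag-n06-l` (g19), 2026-08-28.  NEW file.
-/

namespace Literature.MathematicalPhysics.QuantumFieldTheory.Balaban1983to89.B9Thm313WholeCutLettersSupFrom344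

open Literature.MathematicalPhysics.QuantumFieldTheory.Balaban1983to89
open Finset B6RandomWalk B6RandomWalkHom B9Thm34Ext B11SectG B9SectDSup B9SectDL2Decay B9Thm37Glue B9Thm312Whole
open B9Thm312WholeClasses B9RWSums343to347Whole B9RWSums343Holder B9PerturbationMajorantAlgebra B9PerturbationMajorantLetters
open B9Thm313WholeRgdFrom3152 B9Thm312WholeLeaf B9Thm312WholeHolder B9Thm312WholeHHolder B9Thm313WholeHolder B9Thm313Whole

noncomputable section

variable {g : B9.Geometry} {B : B9.Backgrounds} {X Y Z W PX PY : Type} [Fintype X] [Fintype Y] [Fintype Z] [Fintype W] [Fintype PX]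
  [Fintype g.Site]
variable {R₀ : ℝ} {H₀ : Prop}

/-! ## §1 The letters PD\* and DG′ in the integer sup classes -/

omit [Fintype PX] in
/-- Scalars on a majorant into a weighted sharp-block sup class: `r • T` has the majorant `|r|·K`. [folklore] -/
private theorem hasMaj_smul_wt {F : Type} [AddCommGroup F] [Module ℝ F] {V : Type} [Fintype V] {b₁ : BlockNorm (toB6 g R₀ H₀) F}
    {blk : V → g.Site} {Wt : g.Site → ℝ} {hWt : ∀ y, 0 ≤ Wt y} {T : F →ₗ[ℝ] (V → ℝ)} {K : g.Site → g.Site → ℝ}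
    (h : HasMaj b₁ (weightNorm (BlockNorm.ofBlocks (toB6 g R₀ H₀) blk) Wt hWt) T K) (r : ℝ) :
    HasMaj b₁ (weightNorm (BlockNorm.ofBlocks (toB6 g R₀ H₀) blk) Wt hWt) (r • T) (fun a b => |r| * K a b) := by
  intro y' μ hμ y
  have hb := h y' μ hμ y
  rw [weightNorm_loc] at hb ⊢
  rw [LinearMap.smul_apply, ofBlocks_loc_smul]
  calc Wt y * (|r| * (BlockNorm.ofBlocks (toB6 g R₀ H₀) blk).loc y (T μ))
      = |r| * (Wt y * (BlockNorm.ofBlocks (toB6 g R₀ H₀) blk).loc y (T μ)) := by ring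
    _ ≤ |r| * (K y y' * b₁.loc y' μ) := mul_le_mul_of_nonneg_left hb (abs_nonneg r)
    _ = |r| * K y y' * b₁.loc y' μ := by ring

omit [Fintype PX] in
/-- A majorant into `cNorm … 0` is the same majorant into 𝔠^{(0)} = `cNormR … 0` (the two weights agree). [cite: Balaban1985BackgroundPropagators, (3.42) p.397 (bookkeeping)] -/
private theorem hasMaj_tgt_R0 {F : Type} [AddCommGroup F] [Module ℝ F] (hG : GeoOK g) {b₁ : BlockNorm (toB6 g R₀ H₀) F} {blkW : W → g.Site}
    {T : F →ₗ[ℝ] (W → ℝ)} {K : g.Site → g.Site → ℝ} (h : HasMaj b₁ (cNorm R₀ H₀ blkW hG.lenle 0) T K) :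
    HasMaj b₁ (cNormR R₀ H₀ blkW hG.lenle 0) T K := by
  intro y' μ hμ y
  have e := cNormR_loc_neg_natCast (R₀ := R₀) (H₀ := H₀) hG blkW 0 y (T μ)
  simp only [Nat.cast_zero, neg_zero] at e
  rw [e]
  exact h y' μ hμ y

omit [Fintype PX] in
/-- **P∇\* FROM THE CLASS 𝔠⁽¹⁾ INTO 𝔠_W⁽⁰⁾** ((3.49): |(P∇\*f)(x)| ≦ C_P(Lʲη)⁻¹e^{−δd}|f| read by one [4]-(2.60) shift): constant C_P·L, rate δ − αδ (δ ≦ δ_P the member-facts rate).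
[cite: Balaban1985BackgroundPropagators, (3.49) p.399 + p.398 (remark after (3.47)); Balaban1984PropagatorsII, Lemma 2.1 (2.60) p.234] -/
theorem hasMaj_PDvs_cut (hG : GeoOK g) {dF : ℕ} {δ α L₀ : ℝ} (hF : Facts347 g R₀ H₀ dF δ α L₀) {blkW : W → g.Site} {blk : X → g.Site}
    {P : Module.End ℝ (W → ℝ)} {Dv : (W → ℝ) →ₗ[ℝ] (X → ℝ)} {Dvs : (X → ℝ) →ₗ[ℝ] (W → ℝ)} {CP δP : ℝ}
    (h49 : Proj349Maj blkW blk P Dv Dvs R₀ H₀ CP δP) (hCP : 0 ≤ CP) (hδP : δ ≤ δP) :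
    HasMaj (cNorm R₀ H₀ blk hG.lenle 1) (cNorm R₀ H₀ blkW hG.lenle 0) (P ∘ₗ Dvs)
      (fun a b => CP * g.L * Real.exp (-((δ - α * δ) * g.dist a b))) := by
  have h0 := h49.pDvs_cls hG hCP hδP
  have h1 := hasMaj_shift hG hF (-1) (by norm_num) hCP h0
  rw [rpow_abs_eq_pow g.L (-1) 1 (by norm_num), pow_one] at h1
  have h2 : HasMaj (cNormR R₀ H₀ blk hG.lenle (-((1 : ℕ) : ℝ))) (cNormR R₀ H₀ blkW hG.lenle (-((0 : ℕ) : ℝ))) (P ∘ₗ Dvs)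
      (fun a b => CP * g.L * Real.exp (-((δ - α * δ) * g.dist a b))) := by
    have e1 : ((0 : ℝ) + -1) = -((1 : ℕ) : ℝ) := by norm_num
    have e2 : ((1 : ℝ) + -1) = -((0 : ℕ) : ℝ) := by norm_num
    rw [e1, e2] at h1
    exact h1
  exact hasMaj_ofR hG h2

omit [Fintype PX] in
/-- **∇G′ FROM 𝔠_W⁽⁰⁾ INTO 𝔠⁽¹⁾** (Theorem 3.1 (3.42)₂ for G′, `Thm31GpMaj.e1`): constant B₀, any rate r ≦ δ₀. [cite: Balaban1985BackgroundPropagators, Thm 3.1 (3.42) p.397] -/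
theorem hasMaj_DvGp_cut (hG : GeoOK g) {blkW : W → g.Site} {blk : X → g.Site} {Gp : Module.End ℝ (W → ℝ)}
    {Dv : (W → ℝ) →ₗ[ℝ] (X → ℝ)} {Dvs : (X → ℝ) →ₗ[ℝ] (W → ℝ)} {B₀ δ₀ r : ℝ}
    (h31 : Thm31GpMaj blkW blk Gp Dv Dvs R₀ H₀ B₀ δ₀) (hB₀ : 0 ≤ B₀) (hr : r ≤ δ₀) :
    HasMaj (cNorm R₀ H₀ blkW hG.lenle 0) (cNorm R₀ H₀ blk hG.lenle 1) (Dv ∘ₗ Gp) (fun a b => B₀ * Real.exp (-(r * g.dist a b))) := by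
  have h0 := h31.dvGp_cls hG hB₀ hr
  have h1 : HasMaj (cNormR R₀ H₀ blkW hG.lenle (-((0 : ℕ) : ℝ))) (cNormR R₀ H₀ blk hG.lenle (-((1 : ℕ) : ℝ))) (Dv ∘ₗ Gp)
      (fun a b => B₀ * Real.exp (-(r * g.dist a b))) := by
    simpa only [Nat.cast_zero, neg_zero, Nat.cast_one] using h0
  exact hasMaj_ofR hG h1

/-! ## §2 `Letters313Zc.wGp` from (3.44) for G′ at the class of G₁∇*_U -/

omit [Fintype Y] [Fintype Z] [Fintype PX] in
/-- ★★ **THE ORDER-ZERO SUP LETTER D·G′·R·D\* OF THE RE-CUT SCHEMA (`Letters313Zc.wGp`) IS (3.44) FOR G′ AT THE SAME CLASS, UP TO DERIVED MATERIAL**: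
with R = ϱ(I − P), D·G′·R·D\* = ϱ(DG′D\* − (DG′)(PD\*)); the first word is the letter `h44` — (3.44) for the SITE propagator G′ read from the free class `bXH`
into 𝔠⁽¹⁾ (printed species; at the N06 pins the certificate's input-norm reading of G′) —, the second is (DG′ : 𝔠_W⁽⁰⁾ → 𝔠⁽¹⁾, `Thm31GpMaj.e1`) ∘ (PD\* : 𝔠⁽¹⁾ →
𝔠_W⁽⁰⁾, (3.49) + (2.60)) ∘ (the class embedding `hX` : bXH → 𝔠⁽¹⁾, κ_X), two compositions at the margin σ.  Hence `HasMaj bXH 𝔠⁽¹⁾ (D∘G′∘R∘D\*) (B₃e^{−δ₃d})`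
for any B₃ ≧ ϱ(B₄₄ + B₀·C_P·L₀·κ_X·c²) and any δ₃ ≦ δ − αδ − 2σ (δ the member-facts rate ≦ δ₀, δ_P; δ − αδ − σ ≦ δ_X; δ − αδ − 2σ ≦ δ₄₄).  Nothing of print
asserted. [cite: Balaban1985BackgroundPropagators, (3.44) p.398 + Thm 3.1 (3.42) p.397 + (3.49) p.399 + (3.152)–(3.153) p.426 + Thm 3.13 p.426; Balaban1984PropagatorsII, (2.52)–(2.56) pp.232–233 + Lemma 2.1 (2.60)–(2.61) p.234] -/
theorem wGp_of_h44Gp (hG : GeoOK g) {dF : ℕ} {δ α L₀ σ c : ℝ} (hF : Facts347 g R₀ H₀ dF δ α L₀)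
    (hrow : RowSum (toB6 g R₀ H₀) σ c) {𝔬 : Ops g B X Y Z W} {Gp P : B.Cfg → Module.End ℝ (W → ℝ)} {U : B.Cfg}
    {bXH : BlockNorm (toB6 g R₀ H₀) (X → ℝ)} {B₀ δ₀ CP δP κX δX B44 δ44 ϱ B₃ δ₃ : ℝ}
    (h31 : Thm31GpMaj 𝔬.blkW 𝔬.blk (Gp U) (𝔬.Dv U) (𝔬.Dvstar U) R₀ H₀ B₀ δ₀)
    (h49 : Proj349Maj 𝔬.blkW 𝔬.blk (P U) (𝔬.Dv U) (𝔬.Dvstar U) R₀ H₀ CP δP)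
    (hR : 𝔬.R U = ϱ • (LinearMap.id - P U))
    (hX : HasMaj bXH (cNorm R₀ H₀ 𝔬.blk hG.lenle 1) LinearMap.id (fun a b => κX * Real.exp (-(δX * g.dist a b))))
    (h44 : HasMaj bXH (cNorm R₀ H₀ 𝔬.blk hG.lenle 1) (𝔬.Dv U ∘ₗ Gp U ∘ₗ 𝔬.Dvstar U)
      (fun a b => B44 * Real.exp (-(δ44 * g.dist a b))))
    (hϱ : 0 ≤ ϱ) (hB₀ : 0 ≤ B₀) (hCP : 0 ≤ CP) (hκX : 0 ≤ κX) (hB44 : 0 ≤ B44) (hc : 0 ≤ c) (hσ : 0 ≤ σ) (hαδ : 0 ≤ α * δ)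
    (hδ₀ : δ ≤ δ₀) (hδP : δ ≤ δP) (hbud : 0 ≤ δ - α * δ - 2 * σ) (hδX : δ - α * δ - σ ≤ δX) (hδ44 : δ - α * δ - 2 * σ ≤ δ44)
    (hB₃ : ϱ * (B44 + B₀ * (CP * L₀) * κX * c * c) ≤ B₃) (hδ₃ : δ₃ ≤ δ - α * δ - 2 * σ) :
    HasMaj bXH (cNorm R₀ H₀ 𝔬.blk hG.lenle 1) (𝔬.Dv U ∘ₗ Gp U ∘ₗ 𝔬.R U ∘ₗ 𝔬.Dvstar U)
      (fun a b => B₃ * Real.exp (-(δ₃ * g.dist a b))) := by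
  have htri : Triangle254 (toB6 g R₀ H₀) := fun a b c => hG.tri a b c
  have hL0 : 0 ≤ g.L := zero_le_one.trans hF.one_le_L
  have hL₀ : g.L ≤ L₀ := hF.L_le
  have hCPL : 0 ≤ CP * g.L := mul_nonneg hCP hL0
  set ρ₁ : ℝ := δ - α * δ - σ with hρ₁
  set ρ : ℝ := δ - α * δ - 2 * σ with hρ
  have hρ0 : 0 ≤ ρ := hbud
  have hρ₁0 : 0 ≤ ρ₁ := by rw [hρ₁]; rw [hρ] at hρ0; linarith
  -- PD* ∘ (embedding) : bXH → 𝔠_W⁽⁰⁾ at the rate ρ₁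
  have hPD := hasMaj_PDvs_cut hG hF h49 hCP hδP
  have hXW := hasMaj_comp_exp (b₁ := bXH) (b₂ := cNorm R₀ H₀ 𝔬.blk hG.lenle 1) (b₃ := cNorm R₀ H₀ 𝔬.blkW hG.lenle 0)
    htri hG.dnn hrow hCPL hκX hρ₁0 (by rw [hρ₁]; linarith) (by rw [hρ₁]; linarith) hPD hX
  simp only [cNorm_κ, one_mul] at hXW
  -- DG′ ∘ (PD* ∘ embedding) : bXH → 𝔠⁽¹⁾ at the rate ρ
  have hDG := hasMaj_DvGp_cut hG h31 hB₀ hδ₀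
  have hT₂ := hasMaj_comp_exp (b₁ := bXH) (b₂ := cNorm R₀ H₀ 𝔬.blkW hG.lenle 0) (b₃ := cNorm R₀ H₀ 𝔬.blk hG.lenle 1)
    htri hG.dnn hrow hB₀ (mul_nonneg (mul_nonneg hCPL hκX) hc) hρ0 (by rw [hρ, hρ₁]; linarith) (by rw [hρ]; linarith) hDG hXW
  simp only [cNorm_κ, one_mul] at hT₂
  -- DG′D* at the rate ρ
  have hT₁ := hasMaj_weaken hG hB44 le_rfl hδ44 h44
  -- ϱ • (DG′D* − DG′PD*)
  have hT₂' : HasMaj bXH (cNorm R₀ H₀ 𝔬.blk hG.lenle 1) ((𝔬.Dv U ∘ₗ Gp U) ∘ₗ (P U ∘ₗ 𝔬.Dvstar U) ∘ₗ LinearMap.id)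
      (fun a b => B₀ * (CP * g.L * κX * c) * c * Real.exp (-(ρ * g.dist a b))) :=
    hT₂.mono fun a b => le_of_eq (by simp only [toB6_dist])
  have hsub := hasMaj_smul_wt (hasMaj_sub_exp hT₁ hT₂') ϱ
  have hop : HasMaj bXH (cNorm R₀ H₀ 𝔬.blk hG.lenle 1) (𝔬.Dv U ∘ₗ Gp U ∘ₗ 𝔬.R U ∘ₗ 𝔬.Dvstar U)
      (fun a b => |ϱ| * ((B44 + B₀ * (CP * g.L * κX * c) * c) * Real.exp (-(ρ * g.dist a b)))) := by
    refine hsub.congr fun f => ?_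
    simp only [LinearMap.smul_apply, LinearMap.sub_apply, LinearMap.comp_apply, LinearMap.id_apply, hR, map_smul, map_sub]
  rw [abs_of_nonneg hϱ] at hop
  -- weaken to (B₃, δ₃)
  have hC0 : 0 ≤ ϱ * (B44 + B₀ * (CP * g.L * κX * c) * c) :=
    mul_nonneg hϱ (add_nonneg hB44 (mul_nonneg (mul_nonneg hB₀ (mul_nonneg (mul_nonneg hCPL hκX) hc)) hc))
  have hCle : ϱ * (B44 + B₀ * (CP * g.L * κX * c) * c) ≤ B₃ := by
    have h1 : B₀ * (CP * g.L * κX * c) * c ≤ B₀ * (CP * L₀) * κX * c * c := by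
      have : CP * g.L * κX * c ≤ CP * L₀ * κX * c := by gcongr
      calc B₀ * (CP * g.L * κX * c) * c ≤ B₀ * (CP * L₀ * κX * c) * c := by gcongr
        _ = B₀ * (CP * L₀) * κX * c * c := by ring
    exact (mul_le_mul_of_nonneg_left (by linarith) hϱ).trans hB₃
  exact hasMaj_weaken hG hC0 hCle hδ₃ (hop.mono fun a b => le_of_eq (by ring))

/-! ## §3 `Letters313HZc.pWE` from (3.45) for G′ at the class of G₁∇*_U -/

omit [Fintype Y] [Fintype Z] in
/-- ★★ **THE ORDER-ZERO PROBE LETTER Φ^X_β∘(D·G′·R·D\*) OF THE RE-CUT SCHEMA (`Letters313HZc.pWE β`) IS (3.45) FOR G′ AT THE SAME CLASS, UP TO DERIVED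
MATERIAL**: Φ^X_β∘(D·G′·R·D\*) = ϱ(Φ^X_β∘DG′D\* − (Φ^X_β∘DG′)(PD\*)); the first word is the letter `hp45` ((3.45) for G′ read from `bXH` into the probe class
𝔠_P^{(β−1)}), the second is (Φ^X_β∘DG′ : 𝔠_W^{(0)} → 𝔠_P^{(β−1)}, the (3.43)₁ probe of ∇G′, letter `hpDG`) ∘ (PD\* : 𝔠⁽¹⁾ → 𝔠_W⁽⁰⁾) ∘ (`hX`).  Hence
`HasMaj bXH 𝔠_P^{(β−1)} (Φ^X_β∘(D∘G′∘R∘D\*)) (Bx·e^{−δ₃d})` for any Bx ≧ ϱ(B₄₅ + B_h·C_P·L₀·κ_X·c²) and any δ₃ ≦ δ − αδ − 2σ (δ − αδ − σ ≦ δ_X; δ − αδ − 2σ ≦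
δ₄₅, δ_h).  Nothing of print asserted.
[cite: Balaban1985BackgroundPropagators, (3.43)–(3.45) p.398 + (3.49) p.399 + (3.152)–(3.153) p.426 + Thm 3.13 p.426; Balaban1984PropagatorsII, (2.52)–(2.56) pp.232–233 + Lemma 2.1 (2.60)–(2.61) p.234] -/
theorem pWE_of_p45Gp (hG : GeoOK g) {dF : ℕ} {δ α L₀ σ c : ℝ} (hF : Facts347 g R₀ H₀ dF δ α L₀)
    (hrow : RowSum (toB6 g R₀ H₀) σ c) {𝔬 : Ops g B X Y Z W} (𝔭 : HolderProbes g B X Y PX PY) {Gp P : B.Cfg → Module.End ℝ (W → ℝ)}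
    {U : B.Cfg} {bXH : BlockNorm (toB6 g R₀ H₀) (X → ℝ)} {CP δP κX δX B45 δ45 Bh δh ϱ Bx δ₃ β : ℝ}
    (h49 : Proj349Maj 𝔬.blkW 𝔬.blk (P U) (𝔬.Dv U) (𝔬.Dvstar U) R₀ H₀ CP δP)
    (hR : 𝔬.R U = ϱ • (LinearMap.id - P U))
    (hX : HasMaj bXH (cNorm R₀ H₀ 𝔬.blk hG.lenle 1) LinearMap.id (fun a b => κX * Real.exp (-(δX * g.dist a b))))
    (hp45 : HasMaj bXH (cNormR R₀ H₀ 𝔭.blkPX hG.lenle (β - 1)) (𝔭.ΦX U β ∘ₗ (𝔬.Dv U ∘ₗ Gp U ∘ₗ 𝔬.Dvstar U))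
      (fun a b => B45 * Real.exp (-(δ45 * g.dist a b))))
    (hpDG : HasMaj (cNormR R₀ H₀ 𝔬.blkW hG.lenle 0) (cNormR R₀ H₀ 𝔭.blkPX hG.lenle (β - 1)) (𝔭.ΦX U β ∘ₗ 𝔬.Dv U ∘ₗ Gp U)
      (fun a b => Bh * Real.exp (-(δh * g.dist a b))))
    (hϱ : 0 ≤ ϱ) (hCP : 0 ≤ CP) (hκX : 0 ≤ κX) (hB45 : 0 ≤ B45) (hBh : 0 ≤ Bh) (hc : 0 ≤ c) (hσ : 0 ≤ σ)
    (hδP : δ ≤ δP) (hbud : 0 ≤ δ - α * δ - 2 * σ) (hδX : δ - α * δ - σ ≤ δX) (hδ45 : δ - α * δ - 2 * σ ≤ δ45) (hδh : δ - α * δ - σ ≤ δh)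
    (hBx : ϱ * (B45 + Bh * (CP * L₀) * κX * c * c) ≤ Bx) (hδ₃ : δ₃ ≤ δ - α * δ - 2 * σ) :
    HasMaj bXH (cNormR R₀ H₀ 𝔭.blkPX hG.lenle (β - 1)) (𝔭.ΦX U β ∘ₗ (𝔬.Dv U ∘ₗ Gp U ∘ₗ 𝔬.R U ∘ₗ 𝔬.Dvstar U))
      (fun a b => Bx * Real.exp (-(δ₃ * g.dist a b))) := by
  have htri : Triangle254 (toB6 g R₀ H₀) := fun a b c => hG.tri a b c
  have hL0 : 0 ≤ g.L := zero_le_one.trans hF.one_le_L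
  have hL₀ : g.L ≤ L₀ := hF.L_le
  have hCPL : 0 ≤ CP * g.L := mul_nonneg hCP hL0
  set ρ₁ : ℝ := δ - α * δ - σ with hρ₁
  set ρ : ℝ := δ - α * δ - 2 * σ with hρ
  have hρ0 : 0 ≤ ρ := hbud
  have hρ₁0 : 0 ≤ ρ₁ := by rw [hρ₁]; rw [hρ] at hρ0; linarith
  -- PD* ∘ (embedding) : bXH → 𝔠_W⁽⁰⁾ at the rate ρ₁, then read in the real class 𝔠_W^{(0)}
  have hPD := hasMaj_PDvs_cut hG hF h49 hCP hδP
  have hXW := hasMaj_comp_exp (b₁ := bXH) (b₂ := cNorm R₀ H₀ 𝔬.blk hG.lenle 1) (b₃ := cNorm R₀ H₀ 𝔬.blkW hG.lenle 0)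
    htri hG.dnn hrow hCPL hκX hρ₁0 (by rw [hρ₁]; linarith) (by rw [hρ₁]; linarith) hPD hX
  simp only [cNorm_κ, one_mul] at hXW
  have hXW' := hasMaj_tgt_R0 hG hXW
  -- Φ∇G′ ∘ (PD* ∘ embedding) : bXH → 𝔠_P^{(β−1)} at the rate ρ
  have hT₂ := hasMaj_comp_exp (b₁ := bXH) (b₂ := cNormR R₀ H₀ 𝔬.blkW hG.lenle 0) (b₃ := cNormR R₀ H₀ 𝔭.blkPX hG.lenle (β - 1))
    htri hG.dnn hrow hBh (mul_nonneg (mul_nonneg hCPL hκX) hc) hρ0 (by rw [hρ, hρ₁]; linarith) (by rw [hρ]; linarith) hpDG hXW'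
  simp only [cNormR_κ, one_mul] at hT₂
  have hT₁ := hasMaj_weaken hG hB45 le_rfl hδ45 hp45
  have hT₂' : HasMaj bXH (cNormR R₀ H₀ 𝔭.blkPX hG.lenle (β - 1))
      ((𝔭.ΦX U β ∘ₗ 𝔬.Dv U ∘ₗ Gp U) ∘ₗ (P U ∘ₗ 𝔬.Dvstar U) ∘ₗ LinearMap.id)
      (fun a b => Bh * (CP * g.L * κX * c) * c * Real.exp (-(ρ * g.dist a b))) :=
    hT₂.mono fun a b => le_of_eq (by simp only [toB6_dist])
  have hsub := hasMaj_smul_wt (hasMaj_sub_exp hT₁ hT₂') ϱ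
  have hop : HasMaj bXH (cNormR R₀ H₀ 𝔭.blkPX hG.lenle (β - 1)) (𝔭.ΦX U β ∘ₗ (𝔬.Dv U ∘ₗ Gp U ∘ₗ 𝔬.R U ∘ₗ 𝔬.Dvstar U))
      (fun a b => |ϱ| * ((B45 + Bh * (CP * g.L * κX * c) * c) * Real.exp (-(ρ * g.dist a b)))) := by
    refine hsub.congr fun f => ?_
    simp only [LinearMap.smul_apply, LinearMap.sub_apply, LinearMap.comp_apply, LinearMap.id_apply, hR, map_smul, map_sub]
  rw [abs_of_nonneg hϱ] at hop
  have hC0 : 0 ≤ ϱ * (B45 + Bh * (CP * g.L * κX * c) * c) :=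
    mul_nonneg hϱ (add_nonneg hB45 (mul_nonneg (mul_nonneg hBh (mul_nonneg (mul_nonneg hCPL hκX) hc)) hc))
  have hCle : ϱ * (B45 + Bh * (CP * g.L * κX * c) * c) ≤ Bx := by
    have h1 : Bh * (CP * g.L * κX * c) * c ≤ Bh * (CP * L₀) * κX * c * c := by
      calc Bh * (CP * g.L * κX * c) * c ≤ Bh * (CP * L₀ * κX * c) * c := by gcongr
        _ = Bh * (CP * L₀) * κX * c * c := by ring
    exact (mul_le_mul_of_nonneg_left (by linarith) hϱ).trans hBx
  exact hasMaj_weaken hG hC0 hCle hδ₃ (hop.mono fun a b => le_of_eq (by ring))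

/-! ## §4 `Letters313Zc.gXH` from Theorem 3.3 for G₀, the steps and the defining property of the class of G₁∇*_U -/

/-- ★ **THE LETTER G₁∇\*_U : Y⁰ → bXH OF THE RE-CUT SCHEMA (`Letters313Zc.gXH`) FROM ITS TWO PRINTED COMPONENTS**: if the free class `bXH` is BELOW the
maximum of the 𝔠⁽¹⁾-sup class and the β₀-probe class (`hXcl`: any operator out of 𝔠_Y⁽⁰⁾ bounded into both is bounded into `bXH`, constants adding — the
defining property of a «(sup ⊕ β₀-Hölder)∕Lʲη» class), then G₁∇\*_U : 𝔠_Y⁽⁰⁾ → bXH with constant A₁ + (B_h + θ_H A₁ c) (A₁ = B₀(1−θc)⁻¹) at any rate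
0 ≦ ρ ≦ δ₀ with ρ + σ ≦ δ_K: the sup component is (3.42)₃ for G₁ from Theorem 3.3's (3.42)₃ for G₀ (`he2`) and the step K′₁ on 𝔠⁽¹⁾ (`hK`, θc < 1)
(`B9Thm312WholeHolder.hasMaj_entry2_cNorm`), the probe component is (3.43)₂ for G₁ from the G₀-probe (`h43`) and the probe step (`hpX`)
(`B9Thm313WholeHolder.hasMaj_left_rightR`) — the two words print reads G₁∇\*_Uμ in (Theorem 3.12).  Nothing of print asserted.
[cite: Balaban1985BackgroundPropagators, Thm 3.12 p.423 + (3.138) p.423 + (3.42)–(3.43) pp.397–398 + Thm 3.13 p.426; Balaban1984PropagatorsII, (2.52)–(2.56) pp.232–233 + Lemma 2.1 (2.61) p.234] -/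
theorem gXH_of_closure (hG : GeoOK g) {σ c : ℝ} (hrow : RowSum (toB6 g R₀ H₀) σ c) {𝔬 : Ops g B X Y Z W} (𝔭 : HolderProbes g B X Y PX PY)
    {U : B.Cfg} {bXH : BlockNorm (toB6 g R₀ H₀) (X → ℝ)} {θ θH B₀ Bh β₀ δ₀ δK ρ B₃ δ₃ : ℝ}
    (hc : 0 ≤ c) (hθ : 0 ≤ θ) (hθH : 0 ≤ θH) (hB₀ : 0 ≤ B₀) (hBh : 0 ≤ Bh) (hρ : 0 ≤ ρ) (hρS : ρ ≤ δ₀) (hρδ : ρ + σ ≤ δK) (hq : θ * c < 1)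
    (hK : HasMaj (cNorm R₀ H₀ 𝔬.blk hG.lenle 1) (cNorm R₀ H₀ 𝔬.blk hG.lenle 1) (𝔬.G0 U ∘ₗ (𝔬.Tpi U + 𝔬.T2 U))
      (fun a b => θ * Real.exp (-(δK * g.dist a b))))
    (he2 : HasMajorantHom (g := toB6 g R₀ H₀) 𝔬.blkY 𝔬.blk (𝔬.G0 U ∘ₗ 𝔬.Dstar U)
      (fun a b => B₀ * g.len a * Real.exp (-(δ₀ * g.dist a b))))
    (h43 : HasMajorantHom (g := toB6 g R₀ H₀) 𝔬.blkY 𝔭.blkPX (𝔭.ΦX U β₀ ∘ₗ (𝔬.G0 U ∘ₗ 𝔬.Dstar U))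
      (fun (a b : g.Site) => Bh * g.len a ^ (1 - β₀) * Real.exp (-(δ₀ * g.dist a b))))
    (hpX : HasMaj (cNormR R₀ H₀ 𝔬.blk hG.lenle (-1)) (cNormR R₀ H₀ 𝔭.blkPX hG.lenle (β₀ - 1))
      ((𝔭.ΦX U β₀ ∘ₗ 𝔬.G0 U) ∘ₗ (𝔬.Tpi U + 𝔬.T2 U)) (fun a b => θH * Real.exp (-(δK * g.dist a b))))
    (hI : Identities 𝔬 U)
    (hXcl : ∀ (T : (Y → ℝ) →ₗ[ℝ] (X → ℝ)) (C Cb r : ℝ),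
      HasMaj (cNorm R₀ H₀ 𝔬.blkY hG.lenle 0) (cNorm R₀ H₀ 𝔬.blk hG.lenle 1) T (fun a b => C * Real.exp (-(r * g.dist a b))) →
      HasMaj (cNormR R₀ H₀ 𝔬.blkY hG.lenle 0) (cNormR R₀ H₀ 𝔭.blkPX hG.lenle (β₀ - 1)) (𝔭.ΦX U β₀ ∘ₗ T)
        (fun a b => Cb * Real.exp (-(r * g.dist a b))) →
      HasMaj (cNorm R₀ H₀ 𝔬.blkY hG.lenle 0) bXH T (fun a b => (C + Cb) * Real.exp (-(r * g.dist a b))))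
    (hB₃ : B₀ * (1 - θ * c)⁻¹ + (Bh + θH * (B₀ * (1 - θ * c)⁻¹) * c) ≤ B₃) (hδ₃ : δ₃ ≤ ρ) :
    HasMaj (cNorm R₀ H₀ 𝔬.blkY hG.lenle 0) bXH (𝔬.G1 U ∘ₗ 𝔬.Dstar U) (fun a b => B₃ * Real.exp (-(δ₃ * g.dist a b))) := by
  have hinv : 0 ≤ (1 - θ * c)⁻¹ := inv_nonneg.mpr (by linarith)
  have hA₁ : 0 ≤ B₀ * (1 - θ * c)⁻¹ := mul_nonneg hB₀ hinv
  have hfix1 := fix_of_inverses hI.invG0' hI.invG1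
  -- the sup component: (3.42)₃ for G₁
  have hsup := hasMaj_entry2_cNorm hG hrow hθ hB₀ hρ hρS hρδ hK he2 hfix1 hq
  have hG1 : HasMaj (cNormR R₀ H₀ 𝔬.blkY hG.lenle 0) (cNormR R₀ H₀ 𝔬.blk hG.lenle (-1)) (𝔬.G1 U ∘ₗ 𝔬.Dstar U)
      (fun a b => B₀ * (1 - θ * c)⁻¹ * Real.exp (-(ρ * g.dist a b))) := by
    have h := hasMaj_toR hG hsup
    simp only [Nat.cast_zero, neg_zero, Nat.cast_one] at h
    exact h
  -- the probe component: (3.43)₂ for G₁ (the head E G₀∇* from the G₀-probe, then the probe step)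
  set E : (X → ℝ) →ₗ[ℝ] (PX → ℝ) := 𝔭.ΦX U β₀ with hE
  set bout := cNormR R₀ H₀ 𝔭.blkPX hG.lenle (β₀ - 1) with hbout
  have hE0 : HasMaj (cNormR R₀ H₀ 𝔬.blkY hG.lenle 0) bout (E ∘ₗ 𝔬.G0 U ∘ₗ 𝔬.Dstar U) (fun a b => Bh * Real.exp (-(δ₀ * g.dist a b))) := by
    have h := hasMaj_cNormR_of_hasMajorantHom hG (C := fun a b => Bh * Real.exp (-(δ₀ * g.dist a b)))
      (fun a b => mul_nonneg hBh (Real.exp_nonneg _)) (1 - β₀) 0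
      (hasMajorantHom_mono (g := toB6 g R₀ H₀) 𝔬.blkY 𝔭.blkPX h43 fun a b => le_of_eq (by simp only [Real.rpow_zero, mul_one]; ring))
    have e : -(1 - β₀) = β₀ - 1 := by ring
    rw [e] at h
    exact h
  have hKE : HasMaj (cNormR R₀ H₀ 𝔬.blk hG.lenle (-1)) bout (E ∘ₗ 𝔬.G0 U ∘ₗ (𝔬.Tpi U + 𝔬.T2 U))
      (fun a b => θH * Real.exp (-(δK * g.dist a b))) := hpX
  have hD1 : HasMaj (cNormR R₀ H₀ 𝔬.blkY hG.lenle 0) bout (E ∘ₗ 𝔬.G1 U ∘ₗ 𝔬.Dstar U)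
      (fun y y' => (Bh + θH * (B₀ * (1 - θ * c)⁻¹) * c) * Real.exp (-(ρ * g.dist y y'))) :=
    hasMaj_left_rightR hG hrow hθH hBh hA₁ hρ hρS le_rfl hρδ hKE hE0 hG1 hfix1
  -- the class below the maximum of the two
  have h := hXcl (𝔬.G1 U ∘ₗ 𝔬.Dstar U) (B₀ * (1 - θ * c)⁻¹) (Bh + θH * (B₀ * (1 - θ * c)⁻¹) * c) ρ hsup hD1
  have hC0 : 0 ≤ B₀ * (1 - θ * c)⁻¹ + (Bh + θH * (B₀ * (1 - θ * c)⁻¹) * c) :=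
    add_nonneg hA₁ (add_nonneg hBh (mul_nonneg (mul_nonneg hθH hA₁) hc))
  exact hasMaj_weaken hG hC0 hB₃ hδ₃ h

end

end Literature.MathematicalPhysics.QuantumFieldTheory.Balaban1983to89.B9Thm313WholeCutLettersSupFrom344
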